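/-
Copyright: the b2b-balaban T⁴-continuum CRUX team, row NE7b leaf lineage `t4-ne7b-formalise-leaf-01` (gen 84). Project licence.
-/
import Mathlib.Algebra.BigOperators.Fin
import Mathlib.Algebra.Order.BigOperators.Ring.Finset
import Mathlib.Algebra.Order.Chebyshev
import Mathlib.Data.Matrix.Mul
import Mathlib.Data.Real.Basic
import Mathlib.Tactic.Linarith
import Mathlib.Tactic.Positivity
import Mathlib.Tactic.Ring

/-!
# THE `L¹ ≤ c₅·ℓ²` LETTER OF A LOCAL QUADRATIC FAMILY: site functionals controlled by the field near the site, `|q_x(B)| ≤ c(Σ_{b∈nb x}|B_b|)²`,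
# with neighbourhoods `#nb x ≤ a` and multiplicity `#{x : b ∈ nb x} ≤ μ`, satisfy `Σ_x |q_x(B)| ≤ c·a·μ·‖B‖²` — the `hq` letter (`c₅ := c·a·μ`) of the
# (hJ) slot of print's `γ₀` assembly, hence `|⟨B, 𝒥B⟩| ≤ 2σ·c·a·μ·‖B‖²` (row NE7b, node U5c; `SectE-interface-proof.md` Lemma 5.7, reading R-D «`D̃^{(2)}`
# local homogeneous quadratic with an `L¹ ≤ c₅ℓ²` bound»; [folklore] Cauchy–Schwarz against `1` + the double count)

Cell `pub-balaban`, sub-cell `t4`, spine estimate NE7b (`T4WeightBudget.RelWeightBound`; the cell's OWN estimate — NOT PRINTED in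
[Bałaban 1983–89], NOT PROVED).  Crux-route work under `Spine/NE7b/` by a row leaf (`t4-ne7b-formalise-leaf-01` gen 84) on the windowed
convexity road (R-P1) under FREEZE (0)'s crux-prover clause; NOTHING of Bałaban's is named as a Lean object, valued or asserted; no
`T4Continuum/Support` leaf typed; no `def`; zero `sorry`.  Imports: Mathlib only (`sq_sum_le_card_mul_sum_sq`, `Finset.sum_comm`, `dotProduct`) —
independent of the hub's olean frontier; the consumer `…CurlFormEnergyDomination` (CFED, leaf-05∕06 g153; no hub olean) is met BY SHAPE.

WHY.  The written repair of print's `γ₀` interface ([B9] CMP **99** Sect. E p. 428, GAPS G-B9-09) closes its (hJ) slot by Lemma 5.7: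
«`|⟨B, 𝒥B⟩| = 2|⟨D̃^{(2)}(B), H₁*J⟩| ≤ 2 sup_Λ|H₁*J| · ‖D̃^{(2)}(B)‖_{L¹} ≤ 2c_H Mα₀ · c₅‖B‖² =: θ_J‖B‖²` by (π6), (π7)», with the reading
R-D (census §8.4): «`D̃^{(2)}` local homogeneous quadratic with an `L¹ ≤ c₅ℓ²` bound … what B9 says in words (p. 427) … not displayed».
`…CurlFormEnergyDomination.hJ_of_letters` (CFED §4b) types the `ℓ¹–ℓ^∞` step and DISPLAYS the two letters `|j| ≤ σ` and
`hq : ∀ B, Σ_x |q x B| ≤ c₅ * (B ⬝ᵥ B)`; its NOT-HERE and the pricing desk's debt list keep «(hJ)'s two letters `σ, c₅` BY VALUE ((π6) (3.133)-decay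
of `H₁`, (π7) + reading R-D)».  THIS FILE values the `c₅` letter's SHAPE from the three things R-D actually says — LOCAL (each `q_x` sees the
field on a neighbourhood `nb x` of `≤ a` bonds), HOMOGENEOUS QUADRATIC WITH BOUNDED COEFFICIENTS (`|q_x(B)| ≤ c(Σ_{nb x}|B_b|)²`), and the
lattice's bounded MULTIPLICITY (`≤ μ` sites see a given bond): `c₅ := c·a·μ`; and composes CFED's `ℓ¹–ℓ^∞` step inline (no olean to import)
to print the `hJ` hypothesis of `B9SectEKernel.gamma0_assembly` with `θ := 2σ·c·a·μ`.  (The same double count as this lineage's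
`…AverageDominatedRemainderL2` and leaf-02's `…OneStepAveragingRemainder.sum_sum_filter_le`; statements differ.)

WHAT IS PROVED ([folklore]; sites `X`, bonds `m`, `nb : X → Finset m`, `q : X → (m → ℝ) → ℝ` any site functionals):
* §1 ONE SITE: `sq_sum_abs_le_card_mul_sum_sq` (`(Σ_{s}|B_b|)² ≤ #s·Σ_{s}B_b²`, Mathlib's `sq_sum_le_card_mul_sum_sq`), **`abs_le_of_local_sq`**
  (`|q| ≤ c(Σ_s|B_b|)²`, `c ≥ 0`, `#s ≤ a` ⊢ `|q| ≤ c·a·Σ_s B_b²`).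
* §2 **`sum_sum_le_mul_sum`** (the double count `Σ_x Σ_{b∈nb x} g_b ≤ μ·Σ_b g_b` for `g ≥ 0`).
* §3 **`l1_le_of_local_quadratic`** — THE LETTER: `∀ B, Σ_x |q_x(B)| ≤ c·a·μ·(B ⬝ᵥ B)` (verbatim CFED's `hq` with `c₅ := c·a·μ`).
* §4 THE BILINEAR INSTANCE: `abs_bilinear_local_le` (`|Σ_{b,b′∈s} κ(b,b′)B_bB_{b′}| ≤ c(Σ_s|B_b|)²` for `|κ| ≤ c`), **`l1_le_of_local_bilinear`**
  (coefficient families `κ_x` supported in `nb x × nb x` ⊢ the letter).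
* §5 THE END: **`hJ_of_local_quadratic`** — `⟨B, Jm B⟩ = 2Σ_x j(x)q_x(B)`, `|j| ≤ σ` (`σ ≥ 0`), `q` local quadratic ⊢
  `∀ B, |⟨B, Jm B⟩| ≤ 2σ·(c·a·μ)·(B ⬝ᵥ B)` — the `hJ` of `gamma0_assembly` with `θ := 2σ·c·a·μ` (CFED's `hJ_of_letters` with `hq` supplied, inlined).
* §6 toy (kernel): one site over two bonds, `q(B) = B₀B₁`: `|B₀B₁| ≤ 2(B₀² + B₁²)`.

NOT HERE (honest): WHICH `q` — the identification of print's `D̃^{(2)}(B)` (p. 427, the second-order part of the `D̃`-operation) as such a family and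
its coefficient bound `c`, neighbourhood size `a`, multiplicity `μ` BY VALUE ((π7), reading R-D; (A3) ∕ (A1c), NC-NE7b-α UNRULED); the other letter
`σ = c_H Mα₀` ((π6): the (3.133)-decay of `H₁` against `J`); the junction with CFED BY IMPORT (no hub olean — §5 inlines its three-line step).
BY-NAME EFFECT ON THE WALL: NONE (one displayed letter of the (hJ) slot becomes three counted ones and a coefficient bound; the wall is (R2)).
NE7b NOT PRINTED ∕ NOT PROVED; spine PROVED 0∕9; rung (B)+1 on a FINITE torus — NOT infinite volume, NOT the mass gap, NOT Clay.  HONEST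
DEPENDENCY: continuum YM on T⁴ ⇐ BetaPertH ∧ nine spine estimates (0∕9 proved); BetaPertH ⇐ (D1) ∧ (D4) ∧ CAP+tail; G-an2-4 gates asym,
D1 and NE2∕3∕4.
-/

set_option autoImplicit false

open Finset

namespace Summit.QuantumFields.BalabanUV.T4Continuum.NE7b.LocalQuadraticL1Letter

variable {X m : Type*} [Fintype X] [Fintype m] [DecidableEq m]

/-! ## §1 One site: a local quadratic letter is an `ℓ²` letter on the neighbourhood -/

omit [Fintype m] [DecidableEq m] in
/-- `(Σ_{b ∈ s} |B b|)² ≤ #s · Σ_{b ∈ s} (B b)²` (Cauchy–Schwarz against the constant `1`). [folklore] -/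
theorem sq_sum_abs_le_card_mul_sum_sq (s : Finset m) (B : m → ℝ) :
    (∑ b ∈ s, |B b|) ^ 2 ≤ s.card * ∑ b ∈ s, B b ^ 2 := by
  have h := sq_sum_le_card_mul_sum_sq (s := s) (f := fun b => |B b|)
  simpa only [sq_abs] using h

omit [Fintype m] [DecidableEq m] in
/-- **ONE SITE**: `|q B| ≤ c·(Σ_{b ∈ s} |B b|)²` with `c ≥ 0` and `#s ≤ a` ⊢ `|q B| ≤ c·a·Σ_{b ∈ s} (B b)²`. [folklore] -/
theorem abs_le_of_local_sq {q : ℝ} {c : ℝ} (hc : 0 ≤ c) (s : Finset m) {a : ℕ} (ha : s.card ≤ a) (B : m → ℝ)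
    (hq : |q| ≤ c * (∑ b ∈ s, |B b|) ^ 2) : |q| ≤ c * a * ∑ b ∈ s, B b ^ 2 := by
  have h1 := sq_sum_abs_le_card_mul_sum_sq s B
  have hs0 : 0 ≤ ∑ b ∈ s, B b ^ 2 := sum_nonneg fun b _ => sq_nonneg _
  have h2 : (s.card : ℝ) * ∑ b ∈ s, B b ^ 2 ≤ a * ∑ b ∈ s, B b ^ 2 :=
    mul_le_mul_of_nonneg_right (by exact_mod_cast ha) hs0
  calc |q| ≤ c * (∑ b ∈ s, |B b|) ^ 2 := hq
    _ ≤ c * (a * ∑ b ∈ s, B b ^ 2) := mul_le_mul_of_nonneg_left (h1.trans h2) hc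
    _ = c * a * ∑ b ∈ s, B b ^ 2 := by ring

/-! ## §2 The double count: `Σ_x Σ_{b ∈ nb x} g b ≤ μ·Σ_b g b` -/

/-- **THE DOUBLE COUNT** over the whole fine index: `g ≥ 0`, `#{x : b ∈ nb x} ≤ μ` for every `b` ⊢ `Σ_x Σ_{b ∈ nb x} g b ≤ μ·Σ_b g b`.
[folklore] -/
theorem sum_sum_le_mul_sum [DecidableEq X] (nb : X → Finset m) {μ : ℕ} (hμ : ∀ b, (univ.filter fun x => b ∈ nb x).card ≤ μ)
    (g : m → ℝ) (hg : ∀ b, 0 ≤ g b) : ∑ x, ∑ b ∈ nb x, g b ≤ μ * ∑ b, g b := by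
  classical
  have h1 : ∀ x, ∑ b ∈ nb x, g b = ∑ b, if b ∈ nb x then g b else 0 := fun x => by
    rw [← sum_filter]; exact sum_congr (by ext b; simp) fun _ _ => rfl
  rw [sum_congr rfl fun x _ => h1 x, sum_comm, mul_sum]
  refine sum_le_sum fun b _ => ?_
  rw [← sum_filter, sum_const, nsmul_eq_mul]
  exact mul_le_mul_of_nonneg_right (by exact_mod_cast hμ b) (hg b)

/-! ## §3 The letter: a LOCAL quadratic family has `Σ_x |q_x(B)| ≤ c·a·μ·‖B‖²` -/

/-- **THE `L¹ ≤ c₅·ℓ²` LETTER OF A LOCAL QUADRATIC FAMILY.**  A family of site functionals `q_x` of the field `B`, each CONTROLLED BY THE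
FIELD NEAR `x` quadratically — `|q_x(B)| ≤ c·(Σ_{b ∈ nb x} |B_b|)²`, `c ≥ 0` (bounded coefficients, homogeneous of degree two) —, with
neighbourhoods of size `#nb x ≤ a` and multiplicity `#{x : b ∈ nb x} ≤ μ`: `Σ_x |q_x(B)| ≤ c·a·μ·(B ⬝ᵥ B)` — verbatim the `hq` hypothesis
`∀ B, Σ_x |q x B| ≤ c₅ * (B ⬝ᵥ B)` of `…CurlFormEnergyDomination.hJ_of_letters` with `c₅ := c·a·μ`. [folklore] -/
theorem l1_le_of_local_quadratic [DecidableEq X] (nb : X → Finset m) {a μ : ℕ} (ha : ∀ x, (nb x).card ≤ a)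
    (hμ : ∀ b, (univ.filter fun x => b ∈ nb x).card ≤ μ) (q : X → (m → ℝ) → ℝ) {c : ℝ} (hc : 0 ≤ c)
    (hloc : ∀ x B, |q x B| ≤ c * (∑ b ∈ nb x, |B b|) ^ 2) :
    ∀ B : m → ℝ, ∑ x, |q x B| ≤ c * a * μ * (B ⬝ᵥ B) := by
  intro B
  have hBB : B ⬝ᵥ B = ∑ b, B b ^ 2 := by simp only [dotProduct, pow_two]
  calc ∑ x, |q x B| ≤ ∑ x, c * a * ∑ b ∈ nb x, B b ^ 2 :=
        sum_le_sum fun x _ => abs_le_of_local_sq hc (nb x) (ha x) B (hloc x B)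
    _ = c * a * ∑ x, ∑ b ∈ nb x, B b ^ 2 := by rw [mul_sum]
    _ ≤ c * a * (μ * ∑ b, B b ^ 2) :=
        mul_le_mul_of_nonneg_left (sum_sum_le_mul_sum nb hμ (fun b => B b ^ 2) fun b => sq_nonneg _) (by positivity)
    _ = c * a * μ * (B ⬝ᵥ B) := by rw [hBB]; ring

/-! ## §4 The bilinear instance: bounded local coefficients -/

omit [Fintype m] [DecidableEq m] in
/-- **BOUNDED LOCAL COEFFICIENTS GIVE THE LOCAL QUADRATIC CONTROL**: `q_x(B) = Σ_{b ∈ nb x} Σ_{b′ ∈ nb x} κ_x(b,b′)·B_b·B_{b′}` with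
`|κ_x(b,b′)| ≤ c` ⊢ `|q_x(B)| ≤ c·(Σ_{b ∈ nb x} |B_b|)²`. [folklore] -/
theorem abs_bilinear_local_le (s : Finset m) (κ : m → m → ℝ) {c : ℝ} (hκ : ∀ b b', |κ b b'| ≤ c) (B : m → ℝ) :
    |∑ b ∈ s, ∑ b' ∈ s, κ b b' * B b * B b'| ≤ c * (∑ b ∈ s, |B b|) ^ 2 := by
  calc |∑ b ∈ s, ∑ b' ∈ s, κ b b' * B b * B b'| ≤ ∑ b ∈ s, |∑ b' ∈ s, κ b b' * B b * B b'| := abs_sum_le_sum_abs _ _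
    _ ≤ ∑ b ∈ s, ∑ b' ∈ s, |κ b b' * B b * B b'| := sum_le_sum fun b _ => abs_sum_le_sum_abs _ _
    _ ≤ ∑ b ∈ s, ∑ b' ∈ s, c * (|B b| * |B b'|) := by
        refine sum_le_sum fun b _ => sum_le_sum fun b' _ => ?_
        rw [abs_mul, abs_mul, mul_assoc]
        exact mul_le_mul_of_nonneg_right (hκ b b') (by positivity)
    _ = c * (∑ b ∈ s, |B b|) ^ 2 := by
        rw [sq, sum_mul_sum, mul_sum]
        exact sum_congr rfl fun b _ => by rw [mul_sum]

/-- **THE `c₅` LETTER FOR A LOCAL BILINEAR FAMILY**: coefficients `|κ_x(b,b′)| ≤ c` (`c ≥ 0`) supported in `nb x × nb x`, `#nb x ≤ a`,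
multiplicity `≤ μ` ⊢ `∀ B, Σ_x |Σ_{b,b′ ∈ nb x} κ_x(b,b′)B_bB_{b′}| ≤ c·a·μ·(B ⬝ᵥ B)` — `hJ_of_letters`' `hq` with `c₅ := c·a·μ`. [folklore] -/
theorem l1_le_of_local_bilinear [DecidableEq X] (nb : X → Finset m) {a μ : ℕ} (ha : ∀ x, (nb x).card ≤ a)
    (hμ : ∀ b, (univ.filter fun x => b ∈ nb x).card ≤ μ) (κ : X → m → m → ℝ) {c : ℝ} (hc : 0 ≤ c)
    (hκ : ∀ x b b', |κ x b b'| ≤ c) :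
    ∀ B : m → ℝ, ∑ x, |∑ b ∈ nb x, ∑ b' ∈ nb x, κ x b b' * B b * B b'| ≤ c * a * μ * (B ⬝ᵥ B) :=
  l1_le_of_local_quadratic nb ha hμ (fun x B => ∑ b ∈ nb x, ∑ b' ∈ nb x, κ x b b' * B b * B b') hc
    fun x B => abs_bilinear_local_le (nb x) (κ x) (hκ x) B

/-! ## §5 The END in `…CurlFormEnergyDomination.hJ_of_letters`' shape: `|⟨B, 𝒥B⟩| ≤ 2σ·(c·a·μ)·‖B‖²` -/

/-- **THE (hJ) LETTER FROM THREE COUNTED LETTERS AND TWO SIZES**: `⟨B, Jm B⟩ = 2Σ_x j(x)·q_x(B)` with `|j| ≤ σ` (`σ ≥ 0`) and a local quadratic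
family `q` as in §3 ⊢ `∀ B, |⟨B, Jm B⟩| ≤ 2σ(c·a·μ)·(B ⬝ᵥ B)` — the `hJ` hypothesis of `B9SectEKernel.gamma0_assembly` with `θ := 2σ·c·a·μ`
(`…CurlFormEnergyDomination.hJ_of_letters`' `ℓ¹–ℓ^∞` step inlined — that file has no hub olean to import —, its `hq` supplied by §3). [folklore] -/
theorem hJ_of_local_quadratic [DecidableEq X] (Jm : Matrix m m ℝ) (j : X → ℝ) (q : X → (m → ℝ) → ℝ) {σ : ℝ} (hσ : 0 ≤ σ)
    (hJm : ∀ B : m → ℝ, B ⬝ᵥ (Jm.mulVec B) = 2 * ∑ x, j x * q x B) (hj : ∀ x, |j x| ≤ σ)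
    (nb : X → Finset m) {a μ : ℕ} (ha : ∀ x, (nb x).card ≤ a) (hμ : ∀ b, (univ.filter fun x => b ∈ nb x).card ≤ μ)
    {c : ℝ} (hc : 0 ≤ c) (hloc : ∀ x B, |q x B| ≤ c * (∑ b ∈ nb x, |B b|) ^ 2) :
    ∀ B : m → ℝ, |B ⬝ᵥ (Jm.mulVec B)| ≤ 2 * σ * (c * a * μ) * (B ⬝ᵥ B) := by
  intro B
  have hq := l1_le_of_local_quadratic nb ha hμ q hc hloc B
  rw [hJm B, abs_mul, abs_two]
  have h1 : |∑ x, j x * q x B| ≤ ∑ x, |j x * q x B| := abs_sum_le_sum_abs _ _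
  have h2 : ∑ x, |j x * q x B| ≤ σ * ∑ x, |q x B| := by
    rw [mul_sum]
    refine sum_le_sum fun x _ => ?_
    rw [abs_mul]
    exact mul_le_mul_of_nonneg_right (hj x) (abs_nonneg _)
  have h3 : σ * ∑ x, |q x B| ≤ σ * (c * a * μ * (B ⬝ᵥ B)) := mul_le_mul_of_nonneg_left hq hσ
  linarith

/-! ## §6 Toy (kernel): one site, two bonds, `q(B) = B₀B₁` -/

/-- Toy: `X = Fin 1`, `m = Fin 2`, `nb _ = univ` (`a = 2`, `μ = 1`), `q B = B 0 * B 1` (`|q B| ≤ 1·(|B₀| + |B₁|)²`): the letter gives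
`|B₀B₁| ≤ 1·2·1·(B₀² + B₁²)`. -/
example (B : Fin 2 → ℝ) : ∑ _x : Fin 1, |(fun (_ : Fin 1) (B : Fin 2 → ℝ) => B 0 * B 1) 0 B| ≤ 1 * (2 : ℕ) * (1 : ℕ) * (B ⬝ᵥ B) := by
  refine l1_le_of_local_quadratic (X := Fin 1) (fun _ => (univ : Finset (Fin 2))) (fun _ => by simp) (fun b => by simp)
    (fun (_ : Fin 1) (B : Fin 2 → ℝ) => B 0 * B 1) zero_le_one (fun x B => ?_) B
  rw [Fin.sum_univ_two, one_mul, abs_mul]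
  nlinarith [abs_nonneg (B 0), abs_nonneg (B 1)]

end Summit.QuantumFields.BalabanUV.T4Continuum.NE7b.LocalQuadraticL1Letter
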